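import Mathlib
import HarnessLib
import Summits.NavierStokesRegularity.NavierStokesRegularity.Theorems.QuarterLogPincerFlatChainDefs
import Summits.NavierStokesRegularity.NavierStokesRegularity.Theorems.QuarterLogPincerFlatChainKernel
import Summits.NavierStokesRegularity.NavierStokesRegularity.Theorems.QuarterLogPincerFlatChainTypeIEpoch
import Summits.NavierStokesRegularity.NavierStokesRegularity.Theorems.QuarterLogPincerFlatChainRegularBlockTransfer
import Summits.NavierStokesRegularity.NavierStokesRegularity.Theorems.QuarterLogPincerFlatChainLevelConcentration

/-!
# Route `QuarterLogPincer`, crux `TypeIQuantSubcubicExp` (stmt-NavierStokesRegularity-24077), line `flat_chain` —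
# ASSEMBLY: the line's kernel with the LANDED stubs S3 and S4′ plugged in

With S3 `FlatChain.stub_typeIEpoch : TypeIEpoch` (`…FlatChainTypeIEpoch`) and S4′
`FlatChain.stub_regularBlockTransfer : RegularBlockTransfer` (`…FlatChainRegularBlockTransfer`) tree theorems, the line's
sorry-free kernel (`…FlatChainKernel`, verbatim ns-idea-7 g14) gives, BY NAME and UNCONDITIONALLY in S3/S4/S4′:

* `goodLevelTransfer_holds : GoodLevelTransfer` (S4 = S4′ specialised, `goodLevelTransfer_of_regularBlockTransfer`);
* `bpChainRateFlat_of_levelConcentration : LevelConcentration → BPChainRateFlat` (G2♭ ⟸ S1);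
* `typeIQuantCubicExp_of_beadCensus_of_levelConcentration : BeadCensus → LevelConcentration → TypeIQuantCubicExp` —
  LINE g14-1: the R0-rate rung `CubicRung.TypeIQuantCubicExp` ⟸ {the census node `BeadCensus` (OPEN), S1 `LevelConcentration`
  (OPEN; ⟸ Q3 (PROVED in the author's workfile/annex) + Q4 / P)};
* `typeIQuantCubicExp_of_sliceCensus_of_lightSlice : SliceCensus → LightSliceRegular → LevelConcentration → TypeIQuantCubicExp` —
  LINE g14-2: the rung ⟸ {`SliceCensus` (OPEN), β `LightSliceRegular` (open, L), S1}.

HONEST FRAMING: compositions of landed implications; the census nodes and S1 are OPEN, so nothing here proves the rung, ⟨24077⟩,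
the wall W7 or Navier–Stokes regularity (OPEN / not proved).  pub-ns-dss typer (g39), `--supports stmt-NavierStokesRegularity-24077`.
-/

set_option linter.dupNamespace false

noncomputable section

open Summit.NavierStokesRegularity.NavierStokesRegularity.Cruxes.TypeIQuantSubcubicExp.BeadCensus
open Summit.NavierStokesRegularity.NavierStokesRegularity.Cruxes.TypeIQuantSubcubicExp.CubicRung

namespace Summit.NavierStokesRegularity.NavierStokesRegularity.Cruxes.TypeIQuantSubcubicExp.FlatChain

/-- **S4 `GoodLevelTransfer` holds** (S4′ landed, specialised by `goodLevelTransfer_of_regularBlockTransfer`). -/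
theorem goodLevelTransfer_holds : GoodLevelTransfer :=
  goodLevelTransfer_of_regularBlockTransfer stub_regularBlockTransfer

/-- **G2♭ ⟸ S1**: `LevelConcentration → BPChainRateFlat`, with S3 and S4 discharged by the tree. -/
theorem bpChainRateFlat_of_levelConcentration (hconc : LevelConcentration) : BPChainRateFlat :=
  bpChainRateFlat_of_conc hconc stub_typeIEpoch goodLevelTransfer_holds

/-- **LINE g14-1, rung edge with S3/S4 discharged:** `BeadCensus → LevelConcentration → TypeIQuantCubicExp` (the R0-rate
rung `CubicRung.TypeIQuantCubicExp` BY NAME). -/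
theorem typeIQuantCubicExp_of_beadCensus_of_levelConcentration (hcensus : BeadCensus) (hconc : LevelConcentration) :
    TypeIQuantCubicExp :=
  typeIQuantCubicExp_of_beadCensus_of_conc hcensus hconc stub_typeIEpoch goodLevelTransfer_holds

/-- **LINE g14-2, rung edge with S3/S4′ discharged:** `SliceCensus → LightSliceRegular → LevelConcentration →
TypeIQuantCubicExp`. -/
theorem typeIQuantCubicExp_of_sliceCensus_of_lightSlice (hcen : SliceCensus) (hβ : LightSliceRegular)
    (hconc : LevelConcentration) : TypeIQuantCubicExp :=
  typeIQuantCubicExp_of_sliceCensus_conc hcen hβ hconc stub_typeIEpoch stub_regularBlockTransfer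

end Summit.NavierStokesRegularity.NavierStokesRegularity.Cruxes.TypeIQuantSubcubicExp.FlatChain

end

/-!
## Part 2 (appended): S1 discharged — G2♭ `BPChainRateFlat` UNCONDITIONAL; the rung BY NAME from the census node alone

With S1 `levelConcentration_of_stubs : LevelConcentration` a tree theorem (`…FlatChainLevelConcentration`, the author's §11 proof over
P `stub_localEnergySlice` and Q3 `stub_quietSliceSmallCube`, ported verbatim), the part-1 closers lose their `LevelConcentration`
hypothesis: ★ `bpChainRateFlat_holds : BPChainRateFlat` (G2♭ = the flat form B2♭ of the E-chain's B2 `BeadCensus.BPChainRate`,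
now a THEOREM), ★ `typeIQuantCubicExp_of_beadCensus : BeadCensus → TypeIQuantCubicExp` (LINE g14-1: the R0-rate rung
`CubicRung.TypeIQuantCubicExp` BY NAME from the census node ALONE) and `typeIQuantCubicExp_of_sliceCensus_of_lightSlice' :
SliceCensus → LightSliceRegular → TypeIQuantCubicExp` (LINE g14-2: rung ⟸ {`SliceCensus`, β}).  HONEST FRAMING: the census nodes
`BeadCensus` / `SliceCensus` (and β for g14-2) are OPEN; nothing here proves the rung, ⟨24077⟩, W7 or NS regularity.
-/

namespace Summit.NavierStokesRegularity.NavierStokesRegularity.Cruxes.TypeIQuantSubcubicExp.FlatChain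

open Summit.NavierStokesRegularity.NavierStokesRegularity.Cruxes.TypeIQuantSubcubicExp.BeadCensus
open Summit.NavierStokesRegularity.NavierStokesRegularity.Cruxes.TypeIQuantSubcubicExp.CubicRung

/-- ★ **G2♭ `BPChainRateFlat` holds** — Barker–Prange's chain in the sup-rate gauge, flat form (B2♭), UNCONDITIONAL: S1
(`levelConcentration_of_stubs`), S3 (`stub_typeIEpoch`), S4 (`goodLevelTransfer_holds` ⟸ S4′) are tree theorems. -/
theorem bpChainRateFlat_holds : BPChainRateFlat :=
  bpChainRateFlat_of_levelConcentration levelConcentration_of_stubs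

/-- ★ **LINE g14-1 closed down to its census node:** `BeadCensus → TypeIQuantCubicExp` (the R0-rate rung BY NAME). -/
theorem typeIQuantCubicExp_of_beadCensus (hcensus : BeadCensus) : TypeIQuantCubicExp :=
  typeIQuantCubicExp_of_beadCensus_of_levelConcentration hcensus levelConcentration_of_stubs

/-- **LINE g14-2 closed down to {`SliceCensus`, β}:** `SliceCensus → LightSliceRegular → TypeIQuantCubicExp`. -/
theorem typeIQuantCubicExp_of_sliceCensus_of_lightSlice' (hcen : SliceCensus) (hβ : LightSliceRegular) :
    TypeIQuantCubicExp :=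
  typeIQuantCubicExp_of_sliceCensus_of_lightSlice hcen hβ levelConcentration_of_stubs

end Summit.NavierStokesRegularity.NavierStokesRegularity.Cruxes.TypeIQuantSubcubicExp.FlatChain
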